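import Mathlib.Combinatorics.SimpleGraph.Acyclic
import Mathlib.Combinatorics.SimpleGraph.Metric
import Mathlib.Algebra.BigOperators.Finprod
import HarnessLib

/-!
# Finitely supported «harmonic» functions on an infinite tree vanish

Topic `Combinatorics/SimpleGraph` (namespace `Literature.Combinatorics.SimpleGraph.TreeHarmonic`); Mathlib-only; THEOREMS ONLY — no definition,
no instance, no notation, no named fact.  Pure graph theory on a tree `G` (`G.IsTree`) on ANY vertex type; no finiteness or local finiteness of
`G` is assumed (sums are `finsum`s, which the finite support makes honest).

THE MATHEMATICS (the «outermost shell» argument).  Root the tree at a vertex `u`; a vertex `v ≠ u` has EXACTLY ONE neighbour closer to `u` and all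
its other neighbours are farther (§1: Mathlib's `IsTree.dist_eq_dist_add_one_of_adj` + uniqueness of paths).  Hence, if a function is supported in the
ball of radius `d` and `z` is a support point at distance exactly `d`, a suitable vertex just outside the ball «sees» `z` alone:
* §2 (EDGE FUNCTIONS) `eq_zero_of_forall_finsum_adj_eq_zero` — a finitely supported symmetric function `φ` on the (ordered) edges of a tree whose
  sum around EVERY vertex vanishes (`∀ v, ∑ᶠ w, φ v w = 0`) is identically zero: at the outer end `w` of an outermost support edge `{v, w}` the vertex
  sum is `φ w v` alone.  (No degree hypothesis.)
* §3 (VERTEX FUNCTIONS, NEIGHBOUR SUMS) `eq_zero_of_forall_finsum_neighbor_eq` — if every vertex has at least two neighbours, a finitely supported `f`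
  with `∑ᶠ t ∈ N(x), f t = c (f x)` at every vertex `x` (`c 0 = 0`; e.g. an eigenfunction of the adjacency operator) vanishes: at a farther neighbour
  `y` of an outermost support point `z` the neighbour sum is `f z` alone while `f y = 0`.
* §4 (VERTEX FUNCTIONS, DISTANCE-TWO SUMS, ONE PARITY CLASS) `eq_zero_of_forall_finsum_dist_two_eq` — the same for the distance-`2` operator
  `x ↦ ∑ᶠ t ∈ {t ∣ dist x t = 2}, f t`, the relation being required only on a class `T` of vertices stable under distance-`2` steps and containing the
  support (one colour class of the bipartite tree): at a vertex `x` two steps beyond an outermost support point `z` the sphere sum is `f z` alone.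

WHY (consumer-in-waiting).  The elementary route to «a SUPERCUSPIDAL representation of `U(Φ₃)(L⁺_v)` has no parahoric- and no Iwahori-fixed
vector» (cell `hodgecm-mathlib`, census EP-G row (G6) «SC-NO-IWAHORI», G-ROW LEDGER v1): on the Bruhat–Tits TREE of the unramified unitary group
(★ `UnitaryLatticeTreeDefs`), a `K_i`-fixed Hecke eigenvector gives a FINITELY supported (compactly supported matrix coefficient) function on the
type-`i` vertices satisfying the distance-`2` relation of §4 — hence zero; and an Iwahori-fixed vector then gives a finitely supported edge function
with vanishing vertex sums (§2) — hence zero.  No Hecke-algebra structure, Jacquet module or Satake isomorphism is used.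

References.  [cite: Serre1980Trees, Ch. I §2.2–2.3 (trees: geodesics, the distance to a vertex), Ch. II §1.1 (the tree of `SL₂` over a local field)]
-/

open SimpleGraph

namespace Literature.Combinatorics.SimpleGraph.TreeHarmonic

variable {V : Type*} {G : SimpleGraph V}

/-! ## §1 Rooted geometry of a tree: the unique closer neighbour -/

/-- **In a tree every neighbour of `v` is one step closer to or one step farther from the root `u`** (Mathlib, restated with the two cases
named as used below). [cite: Serre1980Trees, Ch. I §2.2] -/
theorem dist_eq_add_one_or_eq_add_one (hG : G.IsTree) (u : V) {v w : V} (h : G.Adj v w) :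
    G.dist u w = G.dist u v + 1 ∨ G.dist u w + 1 = G.dist u v := by
  rcases hG.dist_eq_dist_add_one_of_adj u h with h1 | h1
  · exact Or.inr h1.symm
  · exact Or.inl h1

/-- **The closer neighbour is unique**: the set of neighbours of `v` one step closer to `u` is a subsingleton (each such neighbour is the
penultimate vertex of the unique shortest path `u ⟶ v`; ANY vertex type — the finite-tree form with `[Fintype V]` is ★
`LaplacianTreeEigenvalueMultiplicityPendants.eq_of_adj_of_dist_succ`). [cite: Serre1980Trees, Ch. I §2.2–2.3] -/
theorem subsingleton_setOf_adj_and_dist_add_one_eq (hG : G.IsTree) (u v : V) :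
    ({w | G.Adj v w ∧ G.dist u w + 1 = G.dist u v} : Set V).Subsingleton := by
  obtain ⟨p, hp, hpl⟩ := (hG.connected u v).exists_path_of_dist
  have key : ∀ {w : V}, G.Adj v w → G.dist u w + 1 = G.dist u v → w = p.penultimate := by
    intro w hw hdw
    obtain ⟨q, hq, hql⟩ := (hG.connected u w).exists_path_of_dist
    by_cases hv : v ∈ q.support
    · have hcat := hG.isAcyclic.path_concat hp hq hw hv
      have hlen : q.length = p.length + 1 := by rw [hcat, Walk.length_concat]
      omega
    · exact hG.isAcyclic.eq_penultimate_of_adj_end hp hw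
        (hG.isAcyclic.mem_support_of_ne_mem_support_of_adj_of_isPath hp hq hw hv)
  intro w₁ hw₁ w₂ hw₂
  rw [key hw₁.1 hw₁.2, key hw₂.1 hw₂.2]

/-- **A neighbour that is not the closer one is farther.** [cite: Serre1980Trees, Ch. I §2.2] -/
theorem dist_eq_add_one_of_adj_of_ne (hG : G.IsTree) (u : V) {v w w' : V} (hw : G.Adj v w) (hw' : G.Adj v w')
    (hd : G.dist u w + 1 = G.dist u v) (hne : w' ≠ w) : G.dist u w' = G.dist u v + 1 := by
  rcases dist_eq_add_one_or_eq_add_one hG u hw' with h | h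
  · exact h
  · exact absurd (subsingleton_setOf_adj_and_dist_add_one_eq hG u v ⟨hw', h⟩ ⟨hw, hd⟩) hne

/-- **A vertex with two distinct neighbours has a farther neighbour.** [cite: Serre1980Trees, Ch. I §2.2] -/
theorem exists_adj_dist_eq_add_one (hG : G.IsTree) (u : V) {v w₁ w₂ : V} (h₁ : G.Adj v w₁) (h₂ : G.Adj v w₂) (hne : w₁ ≠ w₂) :
    ∃ w, G.Adj v w ∧ G.dist u w = G.dist u v + 1 := by
  rcases dist_eq_add_one_or_eq_add_one hG u h₁ with h | h
  · exact ⟨w₁, h₁, h⟩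
  · exact ⟨w₂, h₂, dist_eq_add_one_of_adj_of_ne hG u h₁ h₂ h hne.symm⟩

/-- Two steps away from the root along farther neighbours: `x ∼ y ∼ z` with `y` farther than `z` and `x ≠ z` gives `dist u x = dist u z + 2`.
[cite: Serre1980Trees, Ch. I §2.2] -/
theorem dist_eq_add_two (hG : G.IsTree) (u : V) {z y x : V} (hzy : G.Adj z y) (hyx : G.Adj y x) (hy : G.dist u y = G.dist u z + 1) (hxz : x ≠ z) :
    G.dist u x = G.dist u z + 2 := by
  have h := dist_eq_add_one_of_adj_of_ne hG u hzy.symm hyx (by omega) hxz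
  omega

/-- In a tree, `x ∼ y ∼ z` with `x ≠ z` forces `dist x z = 2` (no triangles). [cite: Serre1980Trees, Ch. I §2.2] -/
theorem dist_eq_two_of_adj_adj (hG : G.IsTree) {x y z : V} (hxy : G.Adj x y) (hyz : G.Adj y z) (hxz : x ≠ z) : G.dist x z = 2 := by
  have hle : G.dist x z ≤ 2 := by
    have := SimpleGraph.dist_le (Walk.cons hxy (Walk.cons hyz Walk.nil))
    simpa using this
  have h0 : G.dist x z ≠ 0 := fun h => hxz (((hG.connected x z).dist_eq_zero_iff).1 h)
  have h1 : G.dist x z ≠ 1 := by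
    intro h
    have hadj : G.Adj x z := dist_eq_one_iff_adj.1 h
    -- rooted at `x`: `y` is at distance `1`, `z` at distance `1`, but `z ∼ y` forces `|1 - 1| = 1`
    rcases hG.dist_eq_dist_add_one_of_adj x hyz with h' | h'
    · rw [dist_eq_one_iff_adj.2 hxy, h] at h'; omega
    · rw [dist_eq_one_iff_adj.2 hxy, h] at h'; omega
  omega

/-- A vertex at distance `2` from `x` is reached through a middle vertex: `x ∼ s ∼ t`, `t ≠ x`. [cite: Serre1980Trees, Ch. I §2.2] -/
theorem exists_adj_adj_of_dist_eq_two (hG : G.IsTree) {x t : V} (h : G.dist x t = 2) : ∃ s, G.Adj x s ∧ G.Adj s t ∧ t ≠ x := by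
  obtain ⟨p, -, hpl⟩ := (hG.connected x t).exists_path_of_dist
  rw [h] at hpl
  have htx : t ≠ x := by
    intro htx; subst htx
    have : G.dist t t = 0 := by simp
    omega
  match p, hpl with
  | Walk.cons hxs (Walk.cons hst Walk.nil), _ => exact ⟨_, hxs, hst, htx⟩
  | Walk.cons _ (Walk.cons _ (Walk.cons _ _)), hl => simp at hl
  | Walk.cons _ Walk.nil, hl => simp at hl
  | Walk.nil, hl => simp at hl

/-! ## §2 Edge functions with vanishing vertex sums -/

/-- **A finitely supported edge function on a tree with zero sum around every vertex is zero.**  `φ v w` is the value on the (ordered) edge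
`(v, w)`: symmetric, zero off the edges of `G`, with finitely many non-zero ordered pairs, and `∑ᶠ w, φ v w = 0` at every vertex `v`.  Then
`φ = 0`.  (Proof: at the outer end of an outermost support edge the vertex sum has exactly one term.) [cite: Serre1980Trees, Ch. I §2.2–2.3] -/
theorem eq_zero_of_forall_finsum_adj_eq_zero (hG : G.IsTree) {M : Type*} [AddCommMonoid M] (φ : V → V → M)
    (hsymm : ∀ v w, φ v w = φ w v) (hadj : ∀ v w, φ v w ≠ 0 → G.Adj v w)
    (hfin : (Function.support (Function.uncurry φ)).Finite) (hsum : ∀ v, ∑ᶠ w, φ v w = 0) :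
    ∀ v w, φ v w = 0 := by
  classical
  by_contra hne
  push Not at hne
  obtain ⟨v₀, w₀, h₀⟩ := hne
  -- root at `v₀`; an outermost support pair, measured by the distance of its SECOND vertex
  set u := v₀ with hu
  have hmem : (v₀, w₀) ∈ hfin.toFinset := by simpa [Function.mem_support] using h₀
  obtain ⟨⟨v, w⟩, hvw, hmax⟩ := hfin.toFinset.exists_max_image (fun p : V × V => G.dist u p.2) ⟨_, hmem⟩
  have hφ : φ v w ≠ 0 := by simpa [Function.mem_support] using hvw
  have hmax' : ∀ a b, φ a b ≠ 0 → G.dist u b ≤ G.dist u w := fun a b hab =>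
    hmax (a, b) (by simpa [Function.mem_support] using hab)
  -- `w` is the OUTER end: `dist u w = dist u v + 1` (else the reversed pair beats the maximum)
  have hout : G.dist u w = G.dist u v + 1 := by
    rcases dist_eq_add_one_or_eq_add_one hG u (hadj v w hφ) with h | h
    · exact h
    · have := hmax' w v (by rwa [hsymm])
      omega
  -- at `w`, every support neighbour is the closer neighbour `v`
  have hsingle : ∀ t, t ≠ v → φ w t = 0 := by
    intro t ht
    by_contra hwt
    have hle := hmax' w t hwt
    rcases dist_eq_add_one_or_eq_add_one hG u (hadj w t hwt) with h | h
    · omega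
    · exact ht (subsingleton_setOf_adj_and_dist_add_one_eq hG u w ⟨hadj w t hwt, h⟩ ⟨(hadj v w hφ).symm, by omega⟩)
  have hw := hsum w
  rw [finsum_eq_single (fun t => φ w t) v hsingle, hsymm] at hw
  exact hφ hw

/-! ## §3 Vertex functions: neighbour sums -/

/-- **A finitely supported function on a tree without leaves satisfying `∑_{t ∼ x} f(t) = c(f(x))` at every vertex (with `c 0 = 0`) is zero** —
e.g. a finitely supported eigenfunction of the adjacency operator of an infinite tree all of whose vertices have at least two neighbours.
(Proof: at a farther neighbour `y` of an outermost support point `z` the neighbour sum is `f z` alone and `f y = 0`.) [cite: Serre1980Trees, Ch. I §2.2–2.3] -/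
theorem eq_zero_of_forall_finsum_neighbor_eq (hG : G.IsTree) (hdeg : ∀ v : V, ∃ w₁ w₂, w₁ ≠ w₂ ∧ G.Adj v w₁ ∧ G.Adj v w₂)
    {M : Type*} [AddCommMonoid M] (f : V → M) (hfin : (Function.support f).Finite) (c : M → M) (hc : c 0 = 0)
    (heq : ∀ x, ∑ᶠ t ∈ G.neighborSet x, f t = c (f x)) : f = 0 := by
  classical
  by_contra hne
  obtain ⟨v₀, h₀⟩ : ∃ v, f v ≠ 0 := by
    by_contra h; push Not at h; exact hne (funext h)
  set u := v₀ with hu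
  have hmem : v₀ ∈ hfin.toFinset := by simpa [Function.mem_support] using h₀
  obtain ⟨z, hz, hmax⟩ := hfin.toFinset.exists_max_image (fun t => G.dist u t) ⟨_, hmem⟩
  have hfz : f z ≠ 0 := by simpa [Function.mem_support] using hz
  have hmax' : ∀ t, f t ≠ 0 → G.dist u t ≤ G.dist u z := fun t ht => hmax t (by simpa [Function.mem_support] using ht)
  -- a farther neighbour `y` of `z`
  obtain ⟨w₁, w₂, hne12, h1, h2⟩ := hdeg z
  obtain ⟨y, hzy, hy⟩ := exists_adj_dist_eq_add_one hG u h1 h2 hne12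
  have hfy : f y = 0 := by
    by_contra h; have := hmax' y h; omega
  -- the neighbour sum at `y` is `f z` alone
  have hsingle : ∀ t, t ≠ z → (G.neighborSet y).indicator f t = 0 := by
    intro t ht
    by_cases hty : t ∈ G.neighborSet y
    · rw [Set.indicator_of_mem hty]
      by_contra hft
      have hle := hmax' t hft
      have hyt : G.Adj y t := hty
      have := dist_eq_add_one_of_adj_of_ne hG u hzy.symm hyt (by omega) ht
      omega
    · exact Set.indicator_of_notMem hty _
  have hy := heq y
  rw [finsum_mem_def, finsum_eq_single _ z hsingle, Set.indicator_of_mem (show z ∈ G.neighborSet y from hzy.symm), hfy, hc] at hy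
  exact hfz hy

/-! ## §4 Vertex functions: distance-two sums on one parity class -/

/-- **A finitely supported function on one colour class of a tree without leaves satisfying the distance-`2` relation
`∑_{dist(x,t)=2} f(t) = c(f(x))` on that class (with `c 0 = 0`) is zero** — e.g. a finitely supported eigenfunction of the «distance-2 adjacency»
operator on the type-`i` vertices of a bi-regular tree.  The class `T` need only be stable under distance-`2` steps and contain the support.
(Proof: two steps beyond an outermost support point `z`, along farther neighbours, sits a vertex `x ∈ T` with `f x = 0` whose distance-`2` sphere meets
the support in `z` alone.) [cite: Serre1980Trees, Ch. I §2.2–2.3; Ch. II §1.1] -/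
theorem eq_zero_of_forall_finsum_dist_two_eq (hG : G.IsTree) (hdeg : ∀ v : V, ∃ w₁ w₂, w₁ ≠ w₂ ∧ G.Adj v w₁ ∧ G.Adj v w₂)
    {M : Type*} [AddCommMonoid M] (f : V → M) (hfin : (Function.support f).Finite) (c : M → M) (hc : c 0 = 0)
    (T : Set V) (hT : ∀ x y, G.dist x y = 2 → x ∈ T → y ∈ T) (hfT : Function.support f ⊆ T)
    (heq : ∀ x ∈ T, ∑ᶠ t ∈ {t | G.dist x t = 2}, f t = c (f x)) : f = 0 := by
  classical
  by_contra hne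
  obtain ⟨v₀, h₀⟩ : ∃ v, f v ≠ 0 := by
    by_contra h; push Not at h; exact hne (funext h)
  set u := v₀ with hu
  have hmem : v₀ ∈ hfin.toFinset := by simpa [Function.mem_support] using h₀
  obtain ⟨z, hz, hmax⟩ := hfin.toFinset.exists_max_image (fun t => G.dist u t) ⟨_, hmem⟩
  have hfz : f z ≠ 0 := by simpa [Function.mem_support] using hz
  have hmax' : ∀ t, f t ≠ 0 → G.dist u t ≤ G.dist u z := fun t ht => hmax t (by simpa [Function.mem_support] using ht)
  -- `z ∼ y ∼ x` along farther neighbours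
  obtain ⟨w₁, w₂, hne12, h1, h2⟩ := hdeg z
  obtain ⟨y, hzy, hy⟩ := exists_adj_dist_eq_add_one hG u h1 h2 hne12
  obtain ⟨w₁', w₂', hne12', h1', h2'⟩ := hdeg y
  obtain ⟨x, hyx, hxz⟩ : ∃ x, G.Adj y x ∧ x ≠ z := by
    by_cases hw : w₁' = z
    · exact ⟨w₂', h2', fun h => hne12' (hw.trans h.symm)⟩
    · exact ⟨w₁', h1', hw⟩
  have hx : G.dist u x = G.dist u z + 2 := dist_eq_add_two hG u hzy hyx hy hxz
  have hfx : f x = 0 := by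
    by_contra h; have := hmax' x h; omega
  have hzx : G.dist z x = 2 := dist_eq_two_of_adj_adj hG hzy hyx hxz.symm
  have hxz2 : G.dist x z = 2 := by rw [SimpleGraph.dist_comm]; exact hzx
  have hxT : x ∈ T := hT z x hzx (hfT (Function.mem_support.2 hfz))
  -- the distance-2 sphere of `x` meets the support in `z` alone
  have hsingle : ∀ t, t ≠ z → ({t | G.dist x t = 2} : Set V).indicator f t = 0 := by
    intro t ht
    by_cases htS : t ∈ ({t | G.dist x t = 2} : Set V)
    · rw [Set.indicator_of_mem htS]
      by_contra hft
      have hle := hmax' t hft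
      obtain ⟨s, hxs, hst, htx⟩ := exists_adj_adj_of_dist_eq_two hG htS
      by_cases hsy : s = y
      · subst hsy
        -- `t` is a neighbour of `y` other than `x`; if it were the closer one it would be `z`
        have := dist_eq_add_one_of_adj_of_ne hG u hzy.symm hst (by omega) ht
        omega
      · -- `s` is a farther neighbour of `x`, and `t ≠ x` a neighbour of `s`: two more steps out
        have hs : G.dist u s = G.dist u x + 1 := dist_eq_add_one_of_adj_of_ne hG u hyx.symm hxs (by omega) hsy
        have := dist_eq_add_one_of_adj_of_ne hG u hxs.symm hst (by omega) htx
        omega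
    · exact Set.indicator_of_notMem htS _
  have hxeq := heq x hxT
  rw [finsum_mem_def, finsum_eq_single _ z hsingle, Set.indicator_of_mem (show z ∈ ({t | G.dist x t = 2} : Set V) from hxz2), hfx, hc] at hxeq
  exact hfz hxeq

end Literature.Combinatorics.SimpleGraph.TreeHarmonic
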